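import Summits.Ventures.PercRepro.RankLevelSetTelForm2

/-!
# PercRepro — THE NULLITY SPLIT IN `k` STEPS: the coindependence bound `|B ∖ X| ≤ d − ν(X)` and the `N`-side `nsideTelK`
(p8, gen 21; a feeder for S4 — the top of the `q = 7` window, the rows `47` and below)

THE COINDEPENDENCE BOUND. For a coindependent set `B` (its complement spans) and ANY `X ⊆ E`: `B ∖ X` is coindependent in
`M ／ X` (the cocircuits of `M ／ X` are the cocircuits of `M` inside `E ∖ X`), so `|B ∖ X| ≤ r*(M ／ X) = d − ν(X)`
(`ncard_sdiff_add_ncard_le_of_coindep`: `|B ∖ X| + |X| ≤ r(X) + d`). Hence if some set `X` of rank `≤ 7` has nullity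
`≥ d − i`, every set `B` counted by `#U(p, 7)` (the complements of the spanning sets) has `|B ∖ X| ≤ i`, and
`#U(p, 7) ≤ (Σ_{j ≤ i} C(n, j))·2^{|X|} ≤ (Σ_{j ≤ i} C(n, j))·2^{7 + d − i}` (`topCount_le_of_nullity_ge`). Otherwise every set
of rank `≤ 7` has nullity `≤ d − k`, and the telescoping count runs with the caps `f = min 79 (7 + d − k)`,
`f' = min 39 (6 + d − k)`: its `N`-side is **`nsideTelK p d k S3 S4 S5`** (`k = 0`: `nsideTel`, `k = 1`: `nsideTel2`).
The core RankLevelSetCoreSevenOfFormSplitK takes, per cell, the `k` and the `k + 1` numeric inequalities. Priced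
(work/tools/price_splitk.py): `k = 2` closes the rows `47 … 45`, `k = 3` the row `44`; from `43` the corank `8` binds.
Axioms: standard.
-/

open scoped Matroid

namespace PercRepro

namespace ThmN

open Set

variable {α : Type}

/-- **The coindependence bound**: if `|E| = r(E) + d`, `B` is coindependent (`M✶.Indep B`) and `X ⊆ E`, then
`|B ∖ X| + |X| ≤ r(X) + d` (i.e. `|B ∖ X| ≤ d − ν(X)`): `B ∖ X` is independent in `M✶ ＼ X = (M ／ X)✶`, whose rank is
`r*(E ∖ X) = r(X) + |E ∖ X| − r(E)`. -/
theorem ncard_sdiff_add_ncard_le_of_coindep (M : Matroid α) [M.Finite] {d : ℕ}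
    (hd : M.E.encard = M.eRank + d) {B X : Set α} (hB : M.Coindep B) (hX : X ⊆ M.E) :
    ((B \ X).ncard : ℕ∞) + X.ncard ≤ M.eRk X + d := by
  have hBX : M✶.Indep (B \ X) := (Matroid.coindep_def.1 hB).subset Set.sdiff_subset
  have hdel : (M✶ ＼ X).Indep (B \ X) := Matroid.delete_indep_iff.2 ⟨hBX, Set.disjoint_sdiff_left⟩
  have h1 : (B \ X).encard ≤ (M✶ ＼ X).eRank := hdel.encard_le_eRank
  have h2 : (M✶ ＼ X).eRank = M✶.eRk (M.E \ X) := by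
    rw [show (M✶ ＼ X).eRank = M✶.eRk (M✶.E \ X) from rfl, Matroid.dual_ground]
  have h3 := Matroid.eRk_dual_add_eRank M (M.E \ X) Set.sdiff_subset
  rw [Set.sdiff_sdiff_cancel_left hX] at h3
  -- pass to `ℕ`
  have hXfin : X.Finite := M.ground_finite.subset hX
  have hBfin : (B \ X).Finite := (M.ground_finite.subset (Matroid.coindep_def.1 hB).subset_ground).sdiff
  rw [h2] at h1
  rw [← hBfin.cast_ncard_eq] at h1
  have hneR : M.eRank ≠ ⊤ := (M.eRank_le_encard_ground.trans_lt M.ground_finite.encard_lt_top).ne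
  have hneX : M.eRk X ≠ ⊤ := ((M.eRk_le_encard _).trans_lt hXfin.encard_lt_top).ne
  have hneD : M✶.eRk (M.E \ X) ≠ ⊤ :=
    ((M✶.eRk_le_encard _).trans_lt (M.ground_finite.sdiff).encard_lt_top).ne
  obtain ⟨p, hp⟩ := ENat.ne_top_iff_exists.1 hneR
  obtain ⟨r, hr⟩ := ENat.ne_top_iff_exists.1 hneX
  obtain ⟨s, hs⟩ := ENat.ne_top_iff_exists.1 hneD
  rw [← hp, ← M.ground_finite.cast_ncard_eq] at hd
  rw [← hp, ← hr, ← hs, ← (M.ground_finite.sdiff).cast_ncard_eq] at h3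
  rw [← hs] at h1
  rw [← hr]
  have hEXn : (M.E \ X).ncard + X.ncard = M.E.ncard := Set.ncard_sdiff_add_ncard_of_subset hX M.ground_finite
  have e1 : (B \ X).ncard ≤ s := by exact_mod_cast h1
  have e2 : s + p = r + (M.E \ X).ncard := by exact_mod_cast h3
  have e3 : M.E.ncard = p + d := by exact_mod_cast hd
  have : (B \ X).ncard + X.ncard ≤ r + d := by omega
  exact_mod_cast this

/-- `#{J ⊆ E : |J| ≤ i} ≤ Σ_{j ≤ i} C(|E|, j)`. -/
theorem ncard_subsets_card_le_le (E : Set α) (hE : E.Finite) (i : ℕ) :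
    {J : Set α | J ⊆ E ∧ J.ncard ≤ i}.ncard ≤ ∑ j ∈ Finset.range (i + 1), E.ncard.choose j := by
  induction i with
  | zero =>
    have : {J : Set α | J ⊆ E ∧ J.ncard ≤ 0} ⊆ {J : Set α | J ⊆ E ∧ J.ncard = 0} :=
      fun J hJ => ⟨hJ.1, Nat.le_zero.1 hJ.2⟩
    calc {J : Set α | J ⊆ E ∧ J.ncard ≤ 0}.ncard ≤ {J : Set α | J ⊆ E ∧ J.ncard = 0}.ncard :=
          Set.ncard_le_ncard this (hE.finite_subsets.subset fun J hJ => hJ.1)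
      _ = E.ncard.choose 0 := Set.ncard_powerset_ncard hE 0
      _ = ∑ j ∈ Finset.range (0 + 1), E.ncard.choose j := by rw [zero_add, Finset.sum_range_one]
  | succ i ih =>
    have hsub : {J : Set α | J ⊆ E ∧ J.ncard ≤ i + 1} ⊆
        {J : Set α | J ⊆ E ∧ J.ncard ≤ i} ∪ {J : Set α | J ⊆ E ∧ J.ncard = i + 1} := by
      intro J hJ
      have hJ2 := hJ.2
      by_cases h : J.ncard ≤ i
      · exact Or.inl ⟨hJ.1, h⟩
      · exact Or.inr ⟨hJ.1, by omega⟩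
    have hf1 : {J : Set α | J ⊆ E ∧ J.ncard ≤ i}.Finite := hE.finite_subsets.subset fun J hJ => hJ.1
    have hf2 : {J : Set α | J ⊆ E ∧ J.ncard = i + 1}.Finite := hE.finite_subsets.subset fun J hJ => hJ.1
    calc {J : Set α | J ⊆ E ∧ J.ncard ≤ i + 1}.ncard
        ≤ ({J : Set α | J ⊆ E ∧ J.ncard ≤ i} ∪ {J : Set α | J ⊆ E ∧ J.ncard = i + 1}).ncard :=
          Set.ncard_le_ncard hsub (hf1.union hf2)
      _ ≤ {J : Set α | J ⊆ E ∧ J.ncard ≤ i}.ncard + {J : Set α | J ⊆ E ∧ J.ncard = i + 1}.ncard :=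
          Set.ncard_union_le _ _
      _ ≤ ∑ j ∈ Finset.range (i + 1), E.ncard.choose j + E.ncard.choose (i + 1) := by
          rw [Set.ncard_powerset_ncard hE (i + 1)]
          exact Nat.add_le_add_right ih _
      _ = ∑ j ∈ Finset.range (i + 1 + 1), E.ncard.choose j :=
          (Finset.sum_range_succ (fun j => E.ncard.choose j) (i + 1)).symm

/-- **The top count when a set of rank `≤ 7` has nullity `≥ d − i`**: `#U(p, 7) ≤ (Σ_{j ≤ i} C(n, j))·2^{|X|}` — every
counted set `B = E ∖ A` is coindependent, so `|B ∖ X| ≤ i`, and `B ↦ (B ∩ X, B ∖ X)` injects into `𝒫(X) × {J : |J| ≤ i}`. -/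
theorem topCount_le_of_nullity_ge (M : Matroid α) [M.Finite] {p d i : ℕ}
    (hR : M.eRank = (p : ℕ∞)) (hd : M.E.encard = M.eRank + d) {X : Set α} (hX : X ⊆ M.E)
    (hnul : M.eRk X + d ≤ (X.ncard : ℕ∞) + i) :
    Matroid.topCount M p 7 ≤ (∑ j ∈ Finset.range (i + 1), M.E.ncard.choose j) * 2 ^ X.ncard := by
  classical
  have hXfin : X.Finite := M.ground_finite.subset hX
  unfold Matroid.topCount
  set T := {A : Set α | A ⊆ M.E ∧ M.eRk A = (p : ℕ∞) ∧ M.eRk (M.E \ A) = ((7 : ℕ) : ℕ∞)} with hT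
  set J := {J : Set α | J ⊆ M.E ∧ J.ncard ≤ i} with hJ
  have hJfin : J.Finite := M.ground_finite.finite_subsets.subset fun J hJ => hJ.1
  -- the map `A ↦ ((E ∖ A) ∩ X, (E ∖ A) ∖ X)` into `𝒫 X ×ˢ J`, injective
  have hmaps : ∀ A ∈ T, ((M.E \ A) ∩ X, (M.E \ A) \ X) ∈ (𝒫 X) ×ˢ J := by
    intro A hA
    refine ⟨Set.inter_subset_right, Set.sdiff_subset.trans Set.sdiff_subset, ?_⟩
    have hsp : M.Spanning A := by
      rw [Matroid.spanning_iff_eRk_le']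
      exact ⟨by rw [hR, hA.2.1], hA.1⟩
    have hco : M.Coindep (M.E \ A) := by
      rw [Matroid.coindep_iff_compl_spanning Set.sdiff_subset, Set.sdiff_sdiff_cancel_left hA.1]
      exact hsp
    have h := ncard_sdiff_add_ncard_le_of_coindep M hd hco hX
    have hne : M.eRk X ≠ ⊤ := ((M.eRk_le_encard _).trans_lt hXfin.encard_lt_top).ne
    obtain ⟨r, hr⟩ := ENat.ne_top_iff_exists.1 hne
    rw [← hr] at h hnul
    have e1 : ((M.E \ A) \ X).ncard + X.ncard ≤ r + d := by exact_mod_cast h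
    have e2 : r + d ≤ X.ncard + i := by exact_mod_cast hnul
    show ((M.E \ A) \ X).ncard ≤ i
    omega
  have hinj : Set.InjOn (fun A => ((M.E \ A) ∩ X, (M.E \ A) \ X)) T := by
    intro A hA A' hA' h
    simp only [Prod.mk.injEq] at h
    have h1 : M.E \ A = M.E \ A' := by
      rw [← Set.inter_union_sdiff (M.E \ A) X, ← Set.inter_union_sdiff (M.E \ A') X, h.1, h.2]
    rw [← Set.sdiff_sdiff_cancel_left hA.1, h1, Set.sdiff_sdiff_cancel_left hA'.1]
  have hcard := Set.ncard_le_ncard_of_injOn (fun A => ((M.E \ A) ∩ X, (M.E \ A) \ X)) hmaps hinj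
    (hXfin.powerset.prod hJfin)
  rw [Set.ncard_prod, Set.ncard_powerset X hXfin] at hcard
  calc T.ncard ≤ 2 ^ X.ncard * J.ncard := hcard
    _ ≤ 2 ^ X.ncard * ∑ j ∈ Finset.range (i + 1), M.E.ncard.choose j :=
        Nat.mul_le_mul_left _ (ncard_subsets_card_le_le M.E M.ground_finite i)
    _ = (∑ j ∈ Finset.range (i + 1), M.E.ncard.choose j) * 2 ^ X.ncard := by ring

/-- **The `N`-side of the telescoping count with the caps `k` steps smaller**: `C(n, 7) + Σ_{j < d − 7} Λ(j + 1) + 2^{min 79 (7 + d − k)}`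
with the closure cap `F = min (min 79 (7 + d − k) − 8) (ν₁ − 2)` (`k = 0`: `nsideTel`, `k = 1`: `nsideTel2`). -/
def nsideTelK (p d k S3 S4 S5 : ℕ) : ℚ :=
  (((p + d).choose 7 : ℕ) : ℚ) +
    (∑ j ∈ Finset.range (d - 7), S2.lamTel (((p + d).choose 7 : ℕ) : ℚ)
      (((S3 : ℕ) : ℚ) * (((p + d - 3).choose 5 : ℕ) : ℚ) + ((S4 : ℕ) : ℚ) * (((p + d - 4).choose 4 : ℕ) : ℚ) +
        ((S5 : ℕ) : ℚ) * (((p + d - 5).choose 3 : ℕ) : ℚ) +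
        (((d + 5).choose 6 : ℕ) : ℚ) * (((p + d - 6).choose 2 : ℕ) : ℚ) +
        (((d + 6).choose 7 : ℕ) : ℚ) * (((p + d - 7 : ℕ)) : ℚ) + (((d + 7).choose 8 : ℕ) : ℚ))
      (min (min 79 (7 + d - k) - 8) (max ((d + min 33 d) / 2 + 1) (min 32 (d - 1) + 2) - 2))
      (fun ν => ν + S2.rminF ν) (j + 1)) +
    (2 : ℚ) ^ (min 79 (7 + d - k))

end ThmN

end PercRepro
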